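import Literature.AnabelianGeometry.EtaleTheta.Thm16SubdagAssemblyIII
import Literature.AnabelianGeometry.EtaleTheta.Thm16SubdagFactorRelation
import Literature.AnabelianGeometry.EtaleTheta.Thm16SubdagFdd2Transport
import Literature.AnabelianGeometry.EtaleTheta.Thm16SubdagThetaTransportEquiv
import HarnessLib

/-!
# [EtTh] Theorem 1.6 (iii) — sub-DAG capstone (part 7): `Thm16iii` from print-shaped inputs only (proof-only)

Mochizuki, *The étale theta function and its Frobenioid-theoretic manifestations*, Publ. RIMS **45** (2009),
Thm. 1.6 (iii) pp. 24–25 (printed 250–251), proof p. 25 l.5–38 [cite: MochizukiEtTh2009, Thm 1.6 (iii) p.24].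
abc-iut cell, layer L2, sub-DAG `plan/L2/SUBDAG-EtTh-Thm16.md` (§K row K3; lineage abc-iut-L6-d5, ONE WRITER),
PART 7 — PROOF-ONLY composition of part 6 (`Thm16SubdagFactorRelation`: rows L11 (b), L12–L14 —
`kumUnitsYdd_map_transport_eq`, `exists_kum_factor_infl_of_inversion`), part 8 (`Thm16SubdagThetaLift`: row L13 —
`exists_thetaLift_transport_etaDd`), part 5 (`Thm16SubdagAssemblyIII`: row L15 + (hconj) —
`thm16iii_of_cuspValues`) and file (C) (`Thm16SubdagTransport`: `thm16iii_of_core`).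

* `Thm16Sub.thm16iii_of_printShapedInputs` — [EtTh] Thm. 1.6 (iii) `Thm16iii γ h c Eα Eβ hCβ` from Thm 1.6 (i)
  `h`, a theta companion `c` (rows L01–L10), the β-side standing inputs (`Compat`, `Sec2Hyps`, `Prop15ii`), Thm
  1.6 (ii) (b) on units (`hunits`, row L11), Θ-level lifts `x′`/`y′` of `transport(η̈^Θ_α)` / `conj_σ(η̈^Θ_β)` with
  equal restriction to `Δ_Θ` (Prop. 1.5 (iii) lift clause + «it is a tautology that γ is compatible with the
  symbols log(Θ)», row L13), an inversion action `ι` fixing both up to units and inverting `F̈¹/F̈²` (row L12 =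
  [SemiAnbd] Thm 6.8 (ii) after composing `γ` with `Inn(σ₀)` — absorbed by the `∃ σ` of `Thm16iii` — + the Prop
  1.5 (iii) `ι`-clause), 2-torsion-freeness of `F̈¹/F̈²` (Prop 1.5 (ii) `F̈¹/F̈² ≅ Ẑ·log(Ü)`), and the two cusp
  evaluations at a `CuspidalPointDd` (Prop 1.4 (iii), row L15, abc-iut-w5-d062) — EVERY binder a printed clause;
* `Thm16Sub.thm16iii_of_printShapedInputs'` — the same with (hunits) SUPPLIED from Thm. 1.6 (ii)'s clauses
  (a)(b) for the same companion (`δ` induced by transport on Kummer classes, carrying `O^×_{K̈α}` onto `O^×_{K̈β}`);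
* `Thm16Sub.exists_thetaLift_conj_etaDd` + `thm16iii_of_printShapedInputs''` — the Θ-level lifts `x′`, `y′` and
  their restrictions `log(Θ)` SUPPLIED from Prop 1.5 (iii) (α and β sides; part 8 for `x′`), the inversion clauses
  being stated for every lift;
* `Thm16Sub.thm16iii_of_printedClauses` — FINAL ASSEMBLED FORM: additionally (hunits) SUPPLIED from row L11
  (a) (part 9 `transportPreservesFdd2_of_prop15ii` ⟸ Prop 1.5 (ii) + `γ(Δ^tp_X) = Δ^tp_X`) and (b) (part 6, valuation
  data with the genuine kernel + [AbsAnab] 1.2.1 clauses) — every binder a printed/cited clause;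
* `Thm16Sub.thm16iii_of_printedClauses_inversion` — the same with the inversion action quantified as an automorphism
  `ι_X` of `Π^tp_{Xβ}` (Thm 1.6 (i)-type, with theta companion), acting on `H¹((Π^tp_Ÿ)^Θ, Δ_Θ)` through THE
  intertwining isomorphism of part 10 (`Thm16SubdagThetaTransportEquiv`).
No `def`, no new `Prop`, nothing asserted; the two untyped Prop 1.5 clauses (the `ι`-clause of (iii);
`F̈¹/F̈² ≅ Ẑ` of (ii)) are explicit binders in print shape (sub-DAG debt R14-ι, root owner abc-iut-L2-t1).
HONEST FRAMING: [EtTh] is refereed and undisputed; nothing here bears on [IUTchIII] Cor. 3.12; typed ≠ proved.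
-/

noncomputable section

namespace Literature.AnabelianGeometry.EtaleTheta

open Literature.AnabelianGeometry.SemiGraphs

namespace Thm16Sub

variable {p : ℕ} [Fact p.Prime] {Dα Dβ : ThetaSetting p} {γ : Dα.PiTemp ≃ₜ* Dβ.PiTemp}


/-! ### The `y′`-binders exist: a Θ-level lift of `conj_σ(η̈^Θ)` restricting to `log(Θ)` (Prop. 1.5 (iii)) -/

/-- **The `y′`-side binders of the capstone are supplied by Prop. 1.5 (iii)**: for every `σ ∈ Π^tp_X` there is
a class `y′ ∈ H¹((Π^tp_Ÿ)^Θ, Δ_Θ)` inflating to `conj_σ(η̈^Θ)` and restricting to `log(Θ)` on `Δ_Θ` — namely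
`conj_σ` of THE lift `x′` of `η̈^Θ` (Prop 1.5 (iii): `σ·x′ = x′ − 2a·log(Ü) − a²·log(q̈) + log(u)`, every
correction term in `F̈¹ = Ker(res_{Δ_Θ})` by Prop 1.5 (ii)); inflation commutes with conjugation
(`ContH1.infl_conj`). [cite: MochizukiEtTh2009, Prop 1.5 (iii) p.23] -/
theorem exists_thetaLift_conj_etaDd {D : ThetaSetting p} (hC : D.Compat) (E : D.EtaleThetaData)
    (h15 : ThetaSetting.Prop15iii E hC) (h15ii : ThetaSetting.Prop15ii E.toKummerData hC) (σ : D.PiTemp) :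
    haveI := hC.GtpYdd_normal
    ∃ y' : D.H1Theta (D.GtpYdd.map D.toTheta),
      D.inflTheta D.GtpYdd y' = ContH1.conj D.toTheta D.DeltaTheta σ E.etaDd ∧
      ContH1.res (MonoidHom.id D.GtpTheta) D.DeltaTheta
        (hC.deltaTheta_le_DtpYddTheta.trans (Subgroup.map_mono inf_le_left)) y' = D.logTheta := by
  haveI := hC.GtpYdd_normal
  haveI := hC.GtpYddTheta_normal
  have hη : E.etaDd ∈ E.thetaClasses := ⟨1, E.kumUnitsYdd.one_mem, (one_mul _).symm⟩
  obtain ⟨x', ⟨hx', hres, hΦ⟩, -⟩ := h15 E.etaDd hη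
  obtain ⟨u, -, hu⟩ := hΦ σ
  refine ⟨ContH1.conj (MonoidHom.id D.GtpTheta) D.DeltaTheta (D.toTheta σ) x', ?_, ?_⟩
  · rw [← hx']
    exact ContH1.infl_conj (H₀ := D.GtpYdd) (H' := D.GtpYdd.map D.toTheta)
      (hψ := D.continuous_toTheta) le_rfl σ x'
  · have hker : ∀ z ∈ ThetaSetting.Fdd1 hC, ContH1.res (MonoidHom.id D.GtpTheta) D.DeltaTheta
        (hC.deltaTheta_le_DtpYddTheta.trans (Subgroup.map_mono inf_le_left)) z = 1 :=
      fun z hz => (MonoidHom.mem_ker).mp hz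
    have hF2 : ∀ v : (↥D.Kdd)ˣ, E.kumYdd (E.toKddHat v) ∈ ThetaSetting.Fdd1 hC := fun v =>
      ThetaSetting.Fdd2_le_Fdd1 hC (by rw [h15ii.Fdd2_eq]; exact ⟨_, rfl⟩)
    -- generalise the restriction map (its proof argument is not type-correct at `instances` transparency,
    -- which blocks `rw`/`simp` underneath it)
    have key : ∀ r : D.H1Theta (D.GtpYdd.map D.toTheta) →* D.H1Theta D.DeltaTheta,
        r x' = D.logTheta → (∀ z ∈ ThetaSetting.Fdd1 hC, r z = 1) →
        ∀ (a b : ℤ) (v w : (↥D.Kdd)ˣ),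
          r (x' * E.logUdd ^ a * E.kumYdd (E.toKddHat v) ^ b * E.kumYdd (E.toKddHat w)) = D.logTheta := by
      intro r hr hk a b v w
      rw [map_mul, map_mul, map_mul, map_zpow, map_zpow, hr, hk _ h15ii.logUdd_mem_Fdd1, hk _ (hF2 v),
        hk _ (hF2 w), one_zpow, one_zpow, mul_one, mul_one, mul_one]
    rw [hu]
    exact key _ hres hker _ _ _ _

/-- **[EtTh] Theorem 1.6 (iii) from PRINT-SHAPED INPUTS ONLY** (proof p. 25 l.5–38, rows L11–L15 of the
sub-DAG): given Thm 1.6 (i) `h` and a theta companion `c` (rows L01–L10), the β-side standing inputs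
`Compat`/`Sec2Hyps`/`Prop15ii`, (hunits) = Thm 1.6 (ii) (b) on the unit classes (row L11), Θ-level lifts `x′`
of `transport(η̈^Θ_α)` and `y′` of `conj_σ(η̈^Θ_β)` with equal restriction to `Δ_Θ` («it is a tautology that γ is
compatible with the symbols log(Θ)», row L13), an inversion action `ι` on `H¹((Π^tp_{Ÿβ})^Θ, Δ_Θ)` fixing both up
to `κ(O^×_K̈)` and inverting `F̈¹/F̈²` (row L12 + the Prop 1.5 (iii) `ι`-clause, after composing `γ` with
`Inn(σ₀)` — absorbed by the existential `σ` of `Thm16iii`), 2-torsion-freeness of `F̈¹/F̈²` (Prop 1.5 (ii)), and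
the two cusp evaluations of Prop 1.4 (iii) at a `K̈`-rational cusp with its canonical-integral-structure section
(row L15, abc-iut-w5-d062's `CuspidalPointDd`) — `Thm16iii γ h c Eα Eβ hCβ`. Chain: part 6
`exists_kum_factor_infl_of_inversion` ⟶ part 5 `thm16iii_of_cuspValues` ⟶ file (C) `thm16iii_of_core`.
[cite: MochizukiEtTh2009, Thm 1.6 (iii) p.24] -/
theorem thm16iii_of_printShapedInputs (h : ThetaSetting.Thm16i γ) (c : ThetaSetting.ThetaCompanion γ)
    (Eα : Dα.EtaleThetaData) (Eβ : Dβ.EtaleThetaData) (hCβ : Dβ.Compat) (hSβ : Dβ.Sec2Hyps)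
    (h15ii : ThetaSetting.Prop15ii Eβ.toKummerData hCβ) (σ : Dβ.PiTemp)
    (hunits : Eα.kumUnitsYdd.map (ThetaSetting.transport c h) = Eβ.kumUnitsYdd)
    -- rows L13–L14: Θ-level lifts of the two classes, with equal restriction to `Δ_Θ`
    (x' y' : Dβ.H1Theta (Dβ.GtpYdd.map Dβ.toTheta))
    (hx' : Dβ.inflTheta Dβ.GtpYdd x' = ThetaSetting.transport c h Eα.etaDd)
    (hy' : haveI := hCβ.GtpYdd_normal
      Dβ.inflTheta Dβ.GtpYdd y' = ContH1.conj Dβ.toTheta Dβ.DeltaTheta σ Eβ.etaDd)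
    (hres : ContH1.res (MonoidHom.id Dβ.GtpTheta) Dβ.DeltaTheta
        (hCβ.deltaTheta_le_DtpYddTheta.trans (Subgroup.map_mono inf_le_left)) x' =
      ContH1.res (MonoidHom.id Dβ.GtpTheta) Dβ.DeltaTheta
        (hCβ.deltaTheta_le_DtpYddTheta.trans (Subgroup.map_mono inf_le_left)) y')
    -- row L12 + Prop 1.5 (iii) ι-clause + Prop 1.5 (ii) torsion-freeness of F̈¹/F̈²
    (ι : Dβ.H1Theta (Dβ.GtpYdd.map Dβ.toTheta) ≃* Dβ.H1Theta (Dβ.GtpYdd.map Dβ.toTheta))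
    (hιF1 : ∀ d ∈ ThetaSetting.Fdd1 hCβ, ι d * d ∈ (ThetaSetting.Fdd2 : Subgroup _))
    (hιx : ∃ u ∈ Dβ.unitsOKdd, ι x' = x' * Eβ.kumYdd (Eβ.toKddHat u))
    (hιy : ∃ u ∈ Dβ.unitsOKdd, ι y' = y' * Eβ.kumYdd (Eβ.toKddHat u))
    (htf : ∀ d ∈ ThetaSetting.Fdd1 hCβ, d * d ∈ (ThetaSetting.Fdd2 : Subgroup _) →
      d ∈ (ThetaSetting.Fdd2 : Subgroup _))
    -- row L15: the two cusp evaluations (Prop 1.4 (iii))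
    (y : ThetaSetting.CuspidalPointDd Eβ.toKummerData) {u₁ u₂ v₁ v₂ : (↥Dβ.Kdd)ˣ}
    (hu₁ : u₁ ∈ Dβ.unitsOKdd) (hu₂ : u₂ ∈ Dβ.unitsOKdd)
    (hv : ‖((v₁ : Dβ.Kdd) : PadicAlgCl p)‖ = ‖((v₂ : Dβ.Kdd) : PadicAlgCl p)‖)
    (h₁ : haveI := hCβ.GtpYdd_normal
      y.evalAt (ContH1.res Dβ.toTheta Dβ.DeltaTheta (y.sec_le.trans y.Dpt_le)
        (ContH1.conj Dβ.toTheta Dβ.DeltaTheta σ Eβ.etaDd)) = Eβ.toKddHat (u₁ * v₁))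
    (h₂ : y.evalAt (ContH1.res Dβ.toTheta Dβ.DeltaTheta (y.sec_le.trans y.Dpt_le)
        (ThetaSetting.transport c h Eα.etaDd)) = Eβ.toKddHat (u₂ * v₂)) :
    ThetaSetting.Thm16iii γ h c Eα Eβ hCβ := by
  haveI := hCβ.GtpYdd_normal
  obtain ⟨a, ha⟩ := exists_kum_factor_infl_of_inversion hCβ Eβ.toKummerData h15ii hx' hy' hres ι hιF1
    hιx hιy htf
  exact thm16iii_of_cuspValues h c Eα Eβ hCβ hSβ h15ii σ hunits a ha y hu₁ hu₂ hv h₁ h₂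

/-- **Capstone, Thm 1.6 (ii)-fed form**: as `thm16iii_of_printShapedInputs`, with the units input (row L11 (b))
SUPPLIED from Thm. 1.6 (ii)'s clauses for the same companion `c` — `δ : (K̈α^×)^∧ ⥲ (K̈β^×)^∧` induced by
transport on Kummer classes (a) and carrying `O^×_{K̈α}` onto `O^×_{K̈β}` (b) (`kumUnitsYdd_map_transport_eq`).
[cite: MochizukiEtTh2009, Thm 1.6 (iii) p.24] -/
theorem thm16iii_of_printShapedInputs' (h : ThetaSetting.Thm16i γ) (c : ThetaSetting.ThetaCompanion γ)
    (Eα : Dα.EtaleThetaData) (Eβ : Dβ.EtaleThetaData) (hCβ : Dβ.Compat) (hSβ : Dβ.Sec2Hyps)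
    (h15ii : ThetaSetting.Prop15ii Eβ.toKummerData hCβ) (σ : Dβ.PiTemp)
    -- row L11 (b) via Thm 1.6 (ii) (a)(b)
    (δ : Eα.KddHat ≃* Eβ.KddHat)
    (hδ : ∀ a : Eα.KddHat, ThetaSetting.transport c h (Dα.inflTheta Dα.GtpYdd (Eα.kumYdd a)) =
      Dβ.inflTheta Dβ.GtpYdd (Eβ.kumYdd (δ a)))
    (hδU : (Dα.unitsOKdd.map Eα.toKddHat).map δ.toMonoidHom = Dβ.unitsOKdd.map Eβ.toKddHat)
    -- rows L13–L14
    (x' y' : Dβ.H1Theta (Dβ.GtpYdd.map Dβ.toTheta))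
    (hx' : Dβ.inflTheta Dβ.GtpYdd x' = ThetaSetting.transport c h Eα.etaDd)
    (hy' : haveI := hCβ.GtpYdd_normal
      Dβ.inflTheta Dβ.GtpYdd y' = ContH1.conj Dβ.toTheta Dβ.DeltaTheta σ Eβ.etaDd)
    (hres : ContH1.res (MonoidHom.id Dβ.GtpTheta) Dβ.DeltaTheta
        (hCβ.deltaTheta_le_DtpYddTheta.trans (Subgroup.map_mono inf_le_left)) x' =
      ContH1.res (MonoidHom.id Dβ.GtpTheta) Dβ.DeltaTheta
        (hCβ.deltaTheta_le_DtpYddTheta.trans (Subgroup.map_mono inf_le_left)) y')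
    -- row L12 + Prop 1.5 (iii) ι-clause + torsion-freeness of F̈¹/F̈²
    (ι : Dβ.H1Theta (Dβ.GtpYdd.map Dβ.toTheta) ≃* Dβ.H1Theta (Dβ.GtpYdd.map Dβ.toTheta))
    (hιF1 : ∀ d ∈ ThetaSetting.Fdd1 hCβ, ι d * d ∈ (ThetaSetting.Fdd2 : Subgroup _))
    (hιx : ∃ u ∈ Dβ.unitsOKdd, ι x' = x' * Eβ.kumYdd (Eβ.toKddHat u))
    (hιy : ∃ u ∈ Dβ.unitsOKdd, ι y' = y' * Eβ.kumYdd (Eβ.toKddHat u))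
    (htf : ∀ d ∈ ThetaSetting.Fdd1 hCβ, d * d ∈ (ThetaSetting.Fdd2 : Subgroup _) →
      d ∈ (ThetaSetting.Fdd2 : Subgroup _))
    -- row L15
    (y : ThetaSetting.CuspidalPointDd Eβ.toKummerData) {u₁ u₂ v₁ v₂ : (↥Dβ.Kdd)ˣ}
    (hu₁ : u₁ ∈ Dβ.unitsOKdd) (hu₂ : u₂ ∈ Dβ.unitsOKdd)
    (hv : ‖((v₁ : Dβ.Kdd) : PadicAlgCl p)‖ = ‖((v₂ : Dβ.Kdd) : PadicAlgCl p)‖)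
    (h₁ : haveI := hCβ.GtpYdd_normal
      y.evalAt (ContH1.res Dβ.toTheta Dβ.DeltaTheta (y.sec_le.trans y.Dpt_le)
        (ContH1.conj Dβ.toTheta Dβ.DeltaTheta σ Eβ.etaDd)) = Eβ.toKddHat (u₁ * v₁))
    (h₂ : y.evalAt (ContH1.res Dβ.toTheta Dβ.DeltaTheta (y.sec_le.trans y.Dpt_le)
        (ThetaSetting.transport c h Eα.etaDd)) = Eβ.toKddHat (u₂ * v₂)) :
    ThetaSetting.Thm16iii γ h c Eα Eβ hCβ :=
  thm16iii_of_printShapedInputs h c Eα Eβ hCβ hSβ h15ii σ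
    (kumUnitsYdd_map_transport_eq h c Eα.toKummerData Eβ.toKummerData δ hδ hδU)
    x' y' hx' hy' hres ι hιF1 hιx hιy htf y hu₁ hu₂ hv h₁ h₂

/-- **Capstone, lifts supplied**: as `thm16iii_of_printShapedInputs`, with the Θ-level lifts `x′` (of
`transport(η̈^Θ_α)`, part 8 `exists_thetaLift_transport_etaDd` from Prop 1.5 (iii) on the α side) and `y′` (of
`conj_σ(η̈^Θ_β)`, `exists_thetaLift_conj_etaDd` from Prop 1.5 (iii) on the β side) and their restrictions `log(Θ)`
SUPPLIED — so that the inversion clauses are stated for EVERY lift (equivalently THE lift: inflation is injective,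
abc-iut-L2-t12's `inflTheta_injective`). Remaining binders = printed clauses only: Thm 1.6 (i), a theta companion,
`Compat` (both sides), `Sec2Hyps`/`Prop15ii` (β), `Prop15iii` (both sides), Thm 1.6 (ii) (b) on units, the
inversion action with its two Prop 1.5 (iii)/(ii) clauses + 2-torsion-freeness of `F̈¹/F̈²`, and the two cusp
evaluations of Prop 1.4 (iii). [cite: MochizukiEtTh2009, Thm 1.6 (iii) p.24] -/
theorem thm16iii_of_printShapedInputs'' (h : ThetaSetting.Thm16i γ) (c : ThetaSetting.ThetaCompanion γ)
    (Eα : Dα.EtaleThetaData) (Eβ : Dβ.EtaleThetaData) (hCα : Dα.Compat) (hCβ : Dβ.Compat)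
    (hSβ : Dβ.Sec2Hyps) (h15ii : ThetaSetting.Prop15ii Eβ.toKummerData hCβ)
    (h15α : ThetaSetting.Prop15iii Eα hCα) (h15β : ThetaSetting.Prop15iii Eβ hCβ) (σ : Dβ.PiTemp)
    (hunits : Eα.kumUnitsYdd.map (ThetaSetting.transport c h) = Eβ.kumUnitsYdd)
    -- row L12 + Prop 1.5 (iii) ι-clause (for every Θ-level lift of the two classes) + Prop 1.5 (ii)
    (ι : Dβ.H1Theta (Dβ.GtpYdd.map Dβ.toTheta) ≃* Dβ.H1Theta (Dβ.GtpYdd.map Dβ.toTheta))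
    (hιF1 : ∀ d ∈ ThetaSetting.Fdd1 hCβ, ι d * d ∈ (ThetaSetting.Fdd2 : Subgroup _))
    (hιx : ∀ x' : Dβ.H1Theta (Dβ.GtpYdd.map Dβ.toTheta),
      Dβ.inflTheta Dβ.GtpYdd x' = ThetaSetting.transport c h Eα.etaDd →
        ∃ u ∈ Dβ.unitsOKdd, ι x' = x' * Eβ.kumYdd (Eβ.toKddHat u))
    (hιy : haveI := hCβ.GtpYdd_normal
      ∀ y' : Dβ.H1Theta (Dβ.GtpYdd.map Dβ.toTheta),
        Dβ.inflTheta Dβ.GtpYdd y' = ContH1.conj Dβ.toTheta Dβ.DeltaTheta σ Eβ.etaDd →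
          ∃ u ∈ Dβ.unitsOKdd, ι y' = y' * Eβ.kumYdd (Eβ.toKddHat u))
    (htf : ∀ d ∈ ThetaSetting.Fdd1 hCβ, d * d ∈ (ThetaSetting.Fdd2 : Subgroup _) →
      d ∈ (ThetaSetting.Fdd2 : Subgroup _))
    -- row L15
    (y : ThetaSetting.CuspidalPointDd Eβ.toKummerData) {u₁ u₂ v₁ v₂ : (↥Dβ.Kdd)ˣ}
    (hu₁ : u₁ ∈ Dβ.unitsOKdd) (hu₂ : u₂ ∈ Dβ.unitsOKdd)
    (hv : ‖((v₁ : Dβ.Kdd) : PadicAlgCl p)‖ = ‖((v₂ : Dβ.Kdd) : PadicAlgCl p)‖)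
    (h₁ : haveI := hCβ.GtpYdd_normal
      y.evalAt (ContH1.res Dβ.toTheta Dβ.DeltaTheta (y.sec_le.trans y.Dpt_le)
        (ContH1.conj Dβ.toTheta Dβ.DeltaTheta σ Eβ.etaDd)) = Eβ.toKddHat (u₁ * v₁))
    (h₂ : y.evalAt (ContH1.res Dβ.toTheta Dβ.DeltaTheta (y.sec_le.trans y.Dpt_le)
        (ThetaSetting.transport c h Eα.etaDd)) = Eβ.toKddHat (u₂ * v₂)) :
    ThetaSetting.Thm16iii γ h c Eα Eβ hCβ := by
  haveI := hCβ.GtpYdd_normal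
  obtain ⟨x', hx', hresx⟩ := exists_thetaLift_transport_etaDd h c hCα hCβ Eα h15α
  obtain ⟨y', hy', hresy⟩ := exists_thetaLift_conj_etaDd hCβ Eβ h15β h15ii σ
  exact thm16iii_of_printShapedInputs h c Eα Eβ hCβ hSβ h15ii σ hunits x' y' hx' hy'
    (hresx.trans hresy.symm) ι hιF1 (hιx x' hx') (hιy y' hy') htf y hu₁ hu₂ hv h₁ h₂

/-- **[EtTh] Theorem 1.6 (iii) — FINAL ASSEMBLED FORM of the sub-DAG (rows L01–L15 composed)**: every binder is
a clause print states or cites — Thm 1.6 (i) `h`; a theta companion `c`; row L01 `hΔ : γ(Δ^tp_{Xα}) = Δ^tp_{Xβ}`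
([AbsAnab] Lem. 1.3.8); the standing §1/§2 inputs `Compat` (α, β), `Sec2Hyps` (β), Prop 1.5 (ii) (α, β), Prop 1.5
(iii) (α, β); valuation data with the genuine kernel `unitsHat = O^×_K̈` and the [AbsAnab] Prop. 1.2.1
(iv)(vi)(vii) clauses `DeltaPreservesUnitsAndOne` for the `δ` induced by transport (rows L11 (a) ⟸ part 9,
(b) ⟸ part 6); an inversion action `ι` on `H¹((Π^tp_{Ÿβ})^Θ, Δ_Θ)` with the Prop 1.5 (iii) `ι`-clause (fixes the
lifts of the two classes up to `κ(O^×_K̈)`), «`ι` negates `F̈¹/F̈²`» and 2-torsion-freeness of `F̈¹/F̈² ≅ Ẑ·log(Ü)`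
(rows L12–L14 ⟸ part 6; lifts ⟸ part 8 and `exists_thetaLift_conj_etaDd`); the two Prop 1.4 (iii) cusp
evaluations at a `K̈`-rational cusp with its canonical-integral-structure section (row L15 ⟸ part 5,
abc-iut-w5-d062's `CuspidalPointDd`) — gives `Thm16iii γ h c Eα Eβ hCβ`.
[cite: MochizukiEtTh2009, Thm 1.6 (iii) p.24] -/
theorem thm16iii_of_printedClauses (h : ThetaSetting.Thm16i γ) (c : ThetaSetting.ThetaCompanion γ)
    (hΔ : Dα.DeltaTemp.map γ.toMulEquiv.toMonoidHom = Dβ.DeltaTemp)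
    (Eα : Dα.EtaleThetaData) (Eβ : Dβ.EtaleThetaData) (hCα : Dα.Compat) (hCβ : Dβ.Compat)
    (hSβ : Dβ.Sec2Hyps) (h15iiα : ThetaSetting.Prop15ii Eα.toKummerData hCα)
    (h15ii : ThetaSetting.Prop15ii Eβ.toKummerData hCβ)
    (h15α : ThetaSetting.Prop15iii Eα hCα) (h15β : ThetaSetting.Prop15iii Eβ hCβ) (σ : Dβ.PiTemp)
    -- row L11 (b)(c): valuation data with the genuine kernel and the [AbsAnab] 1.2.1 clauses for the induced δ
    (Vα : ThetaSetting.ValuationHatData Dα Eα.toKummerData)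
    (Vβ : ThetaSetting.ValuationHatData Dβ Eβ.toKummerData)
    (hVα : Vα.unitsHat = Dα.unitsOKdd.map Eα.toKddHat) (hVβ : Vβ.unitsHat = Dβ.unitsOKdd.map Eβ.toKddHat)
    (hV : ∀ δ : Eα.KddHat ≃* Eβ.KddHat,
      (∀ a, ThetaSetting.transport c h (Dα.inflTheta Dα.GtpYdd (Eα.kumYdd a)) =
        Dβ.inflTheta Dβ.GtpYdd (Eβ.kumYdd (δ a))) → DeltaPreservesUnitsAndOne δ Vα Vβ)
    -- rows L12–L14: the inversion action and its clauses
    (ι : Dβ.H1Theta (Dβ.GtpYdd.map Dβ.toTheta) ≃* Dβ.H1Theta (Dβ.GtpYdd.map Dβ.toTheta))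
    (hιF1 : ∀ d ∈ ThetaSetting.Fdd1 hCβ, ι d * d ∈ (ThetaSetting.Fdd2 : Subgroup _))
    (hιx : ∀ x' : Dβ.H1Theta (Dβ.GtpYdd.map Dβ.toTheta),
      Dβ.inflTheta Dβ.GtpYdd x' = ThetaSetting.transport c h Eα.etaDd →
        ∃ u ∈ Dβ.unitsOKdd, ι x' = x' * Eβ.kumYdd (Eβ.toKddHat u))
    (hιy : haveI := hCβ.GtpYdd_normal
      ∀ y' : Dβ.H1Theta (Dβ.GtpYdd.map Dβ.toTheta),
        Dβ.inflTheta Dβ.GtpYdd y' = ContH1.conj Dβ.toTheta Dβ.DeltaTheta σ Eβ.etaDd →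
          ∃ u ∈ Dβ.unitsOKdd, ι y' = y' * Eβ.kumYdd (Eβ.toKddHat u))
    (htf : ∀ d ∈ ThetaSetting.Fdd1 hCβ, d * d ∈ (ThetaSetting.Fdd2 : Subgroup _) →
      d ∈ (ThetaSetting.Fdd2 : Subgroup _))
    -- row L15: the two cusp evaluations
    (y : ThetaSetting.CuspidalPointDd Eβ.toKummerData) {u₁ u₂ v₁ v₂ : (↥Dβ.Kdd)ˣ}
    (hu₁ : u₁ ∈ Dβ.unitsOKdd) (hu₂ : u₂ ∈ Dβ.unitsOKdd)
    (hv : ‖((v₁ : Dβ.Kdd) : PadicAlgCl p)‖ = ‖((v₂ : Dβ.Kdd) : PadicAlgCl p)‖)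
    (h₁ : haveI := hCβ.GtpYdd_normal
      y.evalAt (ContH1.res Dβ.toTheta Dβ.DeltaTheta (y.sec_le.trans y.Dpt_le)
        (ContH1.conj Dβ.toTheta Dβ.DeltaTheta σ Eβ.etaDd)) = Eβ.toKddHat (u₁ * v₁))
    (h₂ : y.evalAt (ContH1.res Dβ.toTheta Dβ.DeltaTheta (y.sec_le.trans y.Dpt_le)
        (ThetaSetting.transport c h Eα.etaDd)) = Eβ.toKddHat (u₂ * v₂)) :
    ThetaSetting.Thm16iii γ h c Eα Eβ hCβ := by
  -- row L11 (a): the induced δ exists (part 9 + file (C))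
  obtain ⟨δ, hδ⟩ := exists_delta_of_transportPreservesFdd2 c h Eα.toKummerData Eβ.toKummerData
    (transportPreservesFdd2_of_prop15ii h c hΔ Eα.toKummerData Eβ.toKummerData hCα hCβ h15iiα h15ii)
  -- row L11 (b): units go to units (part 6)
  have hunits := kumUnitsYdd_map_transport_eq_of_unitsHat h c Eα.toKummerData Eβ.toKummerData Vα Vβ
    hVα hVβ δ hδ (hV δ hδ).1
  exact thm16iii_of_printShapedInputs'' h c Eα Eβ hCα hCβ hSβ h15ii h15α h15β σ hunits ι hιF1 hιx hιy
    htf y hu₁ hu₂ hv h₁ h₂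

/-- **[EtTh] Theorem 1.6 (iii), final form with the inversion automorphism as in print**: as
`thm16iii_of_printedClauses`, but the inversion action is quantified as an AUTOMORPHISM `ι_X` OF `Π^tp_{Xβ}`
preserving `Π^tp_Ÿ` with a theta companion (Prop 1.5 (iii): "automorphisms of `Π^tp_X` of order 2 over `G_K`…"),
its Θ-level action being THE isomorphism `T` of `H¹((Π^tp_Ÿ)^Θ, Δ_Θ)` intertwining inflation with `transport`
(part 10 `exists_thetaTransportEquiv` / `thetaTransportEquiv_unique`); the three inversion clauses are stated for
that `T`. [cite: MochizukiEtTh2009, Thm 1.6 (iii) p.25] -/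
theorem thm16iii_of_printedClauses_inversion (h : ThetaSetting.Thm16i γ) (c : ThetaSetting.ThetaCompanion γ)
    (hΔ : Dα.DeltaTemp.map γ.toMulEquiv.toMonoidHom = Dβ.DeltaTemp)
    (Eα : Dα.EtaleThetaData) (Eβ : Dβ.EtaleThetaData) (hCα : Dα.Compat) (hCβ : Dβ.Compat)
    (hSβ : Dβ.Sec2Hyps) (h15iiα : ThetaSetting.Prop15ii Eα.toKummerData hCα)
    (h15ii : ThetaSetting.Prop15ii Eβ.toKummerData hCβ)
    (h15α : ThetaSetting.Prop15iii Eα hCα) (h15β : ThetaSetting.Prop15iii Eβ hCβ) (σ : Dβ.PiTemp)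
    (Vα : ThetaSetting.ValuationHatData Dα Eα.toKummerData)
    (Vβ : ThetaSetting.ValuationHatData Dβ Eβ.toKummerData)
    (hVα : Vα.unitsHat = Dα.unitsOKdd.map Eα.toKddHat) (hVβ : Vβ.unitsHat = Dβ.unitsOKdd.map Eβ.toKddHat)
    (hV : ∀ δ : Eα.KddHat ≃* Eβ.KddHat,
      (∀ a, ThetaSetting.transport c h (Dα.inflTheta Dα.GtpYdd (Eα.kumYdd a)) =
        Dβ.inflTheta Dβ.GtpYdd (Eβ.kumYdd (δ a))) → DeltaPreservesUnitsAndOne δ Vα Vβ)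
    -- the inversion automorphism of `Π^tp_{Xβ}` and the clauses for its Θ-level action
    (ιX : Dβ.PiTemp ≃ₜ* Dβ.PiTemp) (hι : ThetaSetting.Thm16i ιX) (cι : ThetaSetting.ThetaCompanion ιX)
    (hιF1 : ∀ T : Dβ.H1Theta (Dβ.GtpYdd.map Dβ.toTheta) ≃* Dβ.H1Theta (Dβ.GtpYdd.map Dβ.toTheta),
      (∀ z, Dβ.inflTheta Dβ.GtpYdd (T z) = ThetaSetting.transport cι hι (Dβ.inflTheta Dβ.GtpYdd z)) →
        ∀ d ∈ ThetaSetting.Fdd1 hCβ, T d * d ∈ (ThetaSetting.Fdd2 : Subgroup _))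
    (hιx : ∀ T : Dβ.H1Theta (Dβ.GtpYdd.map Dβ.toTheta) ≃* Dβ.H1Theta (Dβ.GtpYdd.map Dβ.toTheta),
      (∀ z, Dβ.inflTheta Dβ.GtpYdd (T z) = ThetaSetting.transport cι hι (Dβ.inflTheta Dβ.GtpYdd z)) →
        ∀ x' : Dβ.H1Theta (Dβ.GtpYdd.map Dβ.toTheta),
          Dβ.inflTheta Dβ.GtpYdd x' = ThetaSetting.transport c h Eα.etaDd →
            ∃ u ∈ Dβ.unitsOKdd, T x' = x' * Eβ.kumYdd (Eβ.toKddHat u))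
    (hιy : haveI := hCβ.GtpYdd_normal
      ∀ T : Dβ.H1Theta (Dβ.GtpYdd.map Dβ.toTheta) ≃* Dβ.H1Theta (Dβ.GtpYdd.map Dβ.toTheta),
      (∀ z, Dβ.inflTheta Dβ.GtpYdd (T z) = ThetaSetting.transport cι hι (Dβ.inflTheta Dβ.GtpYdd z)) →
        ∀ y' : Dβ.H1Theta (Dβ.GtpYdd.map Dβ.toTheta),
          Dβ.inflTheta Dβ.GtpYdd y' = ContH1.conj Dβ.toTheta Dβ.DeltaTheta σ Eβ.etaDd →
            ∃ u ∈ Dβ.unitsOKdd, T y' = y' * Eβ.kumYdd (Eβ.toKddHat u))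
    (htf : ∀ d ∈ ThetaSetting.Fdd1 hCβ, d * d ∈ (ThetaSetting.Fdd2 : Subgroup _) →
      d ∈ (ThetaSetting.Fdd2 : Subgroup _))
    (y : ThetaSetting.CuspidalPointDd Eβ.toKummerData) {u₁ u₂ v₁ v₂ : (↥Dβ.Kdd)ˣ}
    (hu₁ : u₁ ∈ Dβ.unitsOKdd) (hu₂ : u₂ ∈ Dβ.unitsOKdd)
    (hv : ‖((v₁ : Dβ.Kdd) : PadicAlgCl p)‖ = ‖((v₂ : Dβ.Kdd) : PadicAlgCl p)‖)
    (h₁ : haveI := hCβ.GtpYdd_normal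
      y.evalAt (ContH1.res Dβ.toTheta Dβ.DeltaTheta (y.sec_le.trans y.Dpt_le)
        (ContH1.conj Dβ.toTheta Dβ.DeltaTheta σ Eβ.etaDd)) = Eβ.toKddHat (u₁ * v₁))
    (h₂ : y.evalAt (ContH1.res Dβ.toTheta Dβ.DeltaTheta (y.sec_le.trans y.Dpt_le)
        (ThetaSetting.transport c h Eα.etaDd)) = Eβ.toKddHat (u₂ * v₂)) :
    ThetaSetting.Thm16iii γ h c Eα Eβ hCβ := by
  obtain ⟨T, hT⟩ := exists_thetaTransportEquiv hι cι
  exact thm16iii_of_printedClauses h c hΔ Eα Eβ hCα hCβ hSβ h15iiα h15ii h15α h15β σ Vα Vβ hVα hVβ hV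
    T (hιF1 T hT) (hιx T hT) (hιy T hT) htf y hu₁ hu₂ hv h₁ h₂

end Thm16Sub

end Literature.AnabelianGeometry.EtaleTheta

end
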